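import Literature.AlgebraicGeometry.AbelianSchemes.AbelianSchemeOverRestrictPt
import Literature.AlgebraicGeometry.AbelianSchemes.AbelianSchemeOverField
import HarnessLib

/-!
# `σ^a` read at a geometric point — the fibrewise exponent calculus of a family of sections of an abelian scheme
# ([MumfordFogartyKirwan1994, Ch. 7 §1 Def. 7.1 / App. 7A]; cell hodgecm-mathlib, M1PRIME-DAG §5: W2 `changeLevel`, W4 `twist`)

[MumfordFogartyKirwan1994, Ch. 7 §1 Def. 7.1 (p. 129)] reads a level structure through «the images `σᵢ(s)` form a basis
for the group of points of order `n` on `X̄_s`», i.e. through `Σ aᵢ σᵢ(s)`, a homomorphism `(ℤ/n)^{2g} → X_s[n](Ω)`;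
App. 7A (p. 236) lets `GL`/`CSp` act on level structures by `σ ↦ σ ∘ γ`, and the tower `A_{g,nm} → A_{g,n}` (p. 235)
lowers the level by `σ ↦ m·σ`.  In the tree's carrier (`AbelianSchemeOverBase`) the exponent vector `a : (ℤ/n)^{g ⊔ g}`
enters `A.sectionPow σ a` through `ZMod.val` and ORDERED products (the group of sections over `S` is not declared
commutative).  READ AT A GEOMETRIC POINT `s : Spec Ω → S` the ordered products become honest ones, because the fibre
`A_s` is an abelian variety, hence a COMMUTATIVE group scheme (`Motives.AbelianVariety.instIsCommMonObj` = Mathlib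
`isCommMonObj_of_isProper_of_geometricallyIntegral`, [MumfordFogartyKirwan1994, Cor. 6.5] over a field), so that
`A_s(Ω) = AlgPoints (A.fibre s).X Ω` is commutative (Mathlib's scoped `Hom.commGroup` on the SAME `Hom.group`
`AbelianSchemeOverRestrictPt` computes in) and `a ↦ (σ^a)(s)` is additive in `a` as soon as the `σₖ(s)` are `n`-torsion —
which is all the BASIS clauses of `LevelStructure` (stated at geometric points) ever use.  NO commutativity hypothesis on
`A`; no instance is declared (the commutativity of the fibre is the THEOREM `isCommMonObj_fibre`, invoked by `haveI`).

* `isCommMonObj_fibre` — the fibre over a field-valued point is a commutative group scheme;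
* `restrictPt_sectionPow_eq_prod` — `(σ^a)(s) = ∏ₖ σₖ(s)^{aₖ}` (unordered);
* `restrictPt_sectionPow_add/_zero/_nsmul/_pow_card` — additivity in `a` given `σₖ(s)^n = 1`;
* `restrictPt_sectionPow_mulVec` — `((σ∘γ̄)^a)(s) = (σ^{γ̄ a})(s)` for a matrix `γ̄` acting by COLUMNS
  (`(σ∘γ̄)ᵢ := σ^{col_i γ̄}`, the right action `η ↦ η ∘ γ̄` of App. 7A; M1PRIME-DAG W4 (t2));
* `restrictPt_sectionPow_pow` — `((σ^d)^a)(s) = (σ^{d·a})(s)` (cofactor form of the level-lowering map; W2 (c1)/(c5));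
* the TRANSFER to `LevelStructure`'s own clause shapes (`FibrePoints` currency, via `restrictPt_eq_restrictPt_iff`):
  `basis_injective/_surjective` for the twisted family `σ∘γ̄` (`γ̄` invertible) and for `σ^d` at the lower level.
Theorems only.  The GLOBAL exponent identity (sections over `S`, not points) under Mathlib's `[IsCommMonObj A.X]` lives
in `LevelStructureTwist` (D3 ed.-2); the two coexist.  Cell hodgecm-mathlib, seat B-p11.  HC_CM is proved only modulo
the 7 printed citations until rung 0 closes; this file discharges none of them.

## References
* [MumfordFogartyKirwan1994] D. Mumford, J. Fogarty, F. Kirwan, *Geometric Invariant Theory*, 3rd ed. (1994): Ch. 6 §1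
  Cor. 6.5 (p. 117); Ch. 7 §1 Def. 7.1 (p. 129); App. 7A (pp. 234–236) (held copy
  `book:mumford1994-geometric-invariant-theory`, chunks p0122, p0134, p0230–p0236).
-/

noncomputable section

universe u

open CategoryTheory CategoryTheory.Limits AlgebraicGeometry MonoidalCategory Matrix
open scoped MonObj CategoryTheory.Obj

namespace Literature.AlgebraicGeometry.AbelianSchemes

namespace AbelianSchemeOver

variable {S : Scheme.{u}} (A : AbelianSchemeOver S) {Ω : Type u} [Field Ω] (s : Spec (.of Ω) ⟶ S)
variable {g n : ℕ}

/-! ### §0 The fibre is a commutative group scheme -/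

/-- **The fibre `A_s` of an abelian scheme over a field-valued point is a COMMUTATIVE group scheme** — it is an abelian
variety over `Ω` (`AbelianScheme.toAbelianVariety`), and abelian varieties are commutative
(`Motives.AbelianVariety.instIsCommMonObj`, Mathlib `isCommMonObj_of_isProper_of_geometricallyIntegral`;
[MumfordFogartyKirwan1994, Ch. 6 §1 Cor. 6.5] over a field).  A theorem, not an instance: invoke with `haveI`.
[cite: MumfordFogartyKirwan1994, Ch. 6 §1 Corollary 6.5 (p. 117)] -/
theorem isCommMonObj_fibre : IsCommMonObj (A.fibre s).X :=
  Literature.AlgebraicGeometry.Motives.AbelianVariety.instIsCommMonObj (A.fibre s).toAbelianVariety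

/-! ### §1 Exponent arithmetic in a monoid for `n`-torsion elements (`ZMod.val` bookkeeping; private helpers) -/

/-- In a monoid, `x ↦ P ^ x.val` on `ZMod n` is additive as soon as `P ^ n = 1`. [folklore] -/
private theorem pow_val_add_of_pow_eq_one {M : Type*} [Monoid M] {P : M} [NeZero n] (hP : P ^ n = 1)
    (x y : ZMod n) : P ^ (x + y).val = P ^ x.val * P ^ y.val := by
  rw [ZMod.val_add, ← pow_eq_pow_mod _ hP, pow_add]

/-- In a monoid, `P ^ (x * y).val = (P ^ x.val) ^ y.val` on `ZMod n` as soon as `P ^ n = 1`. [folklore] -/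
private theorem pow_val_mul_of_pow_eq_one {M : Type*} [Monoid M] {P : M} (hP : P ^ n = 1)
    (x y : ZMod n) : P ^ (x * y).val = (P ^ x.val) ^ y.val := by
  rw [ZMod.val_mul, ← pow_eq_pow_mod _ hP, pow_mul]

/-- In a monoid, `P ^ (m : ZMod n).val = P ^ m` for `m : ℕ` as soon as `P ^ n = 1`. [folklore] -/
private theorem pow_val_natCast_of_pow_eq_one {M : Type*} [Monoid M] {P : M} (hP : P ^ n = 1) (m : ℕ) :
    P ^ ((m : ZMod n)).val = P ^ m := by
  rw [ZMod.val_natCast, ← pow_eq_pow_mod _ hP]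

/-- In a commutative monoid, `P ^ (∑ᵢ f i).val = ∏ᵢ P ^ (f i).val` on `ZMod n` as soon as `P ^ n = 1`. [folklore] -/
private theorem pow_val_sum_of_pow_eq_one {M : Type*} [CommMonoid M] {P : M} [NeZero n] (hP : P ^ n = 1)
    {J : Type*} (t : Finset J) (f : J → ZMod n) : P ^ (∑ i ∈ t, f i).val = ∏ i ∈ t, P ^ (f i).val := by
  classical
  induction t using Finset.induction_on with
  | empty => simp
  | insert i t hi ih => rw [Finset.sum_insert hi, Finset.prod_insert hi, pow_val_add_of_pow_eq_one hP, ih]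

/-- For an invertible matrix `γ̄`, `a ↦ γ̄ *ᵥ a` is injective. [folklore] -/
private theorem mulVec_injective_of_isUnit {R : Type*} [CommRing R] {m : Type*} [Fintype m] [DecidableEq m]
    {γ : Matrix m m R} (hγ : IsUnit γ) : Function.Injective fun v : m → R => γ *ᵥ v := by
  obtain ⟨u, rfl⟩ := hγ
  intro a b hab
  have h := congrArg (fun v => (u⁻¹).val *ᵥ v) hab
  simpa only [Matrix.mulVec_mulVec, Units.inv_mul, Matrix.one_mulVec] using h

/-! ### §2 `(σ^a)(s) = ∏ₖ σₖ(s)^{aₖ}` in the commutative group `A_s(Ω)`, and additivity in the exponent -/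

/-- **`(σ^a)(s) = ∏ₖ σₖ(s)^{aₖ}`** as an UNORDERED product over `k : Fin g ⊕ Fin g` in the commutative group `A_s(Ω)`
(commutativity from `isCommMonObj_fibre`, supplied in the statement by `haveI`) — Mumford's `Σ aᵢ σᵢ(s)`; from (O4)'s
ordered `restrictPt_sectionPow` by `List.prod_ofFn` + `Fintype.prod_sum_type`.
[cite: MumfordFogartyKirwan1994, Ch. 7 §1 Definition 7.1 (p. 129)] -/
theorem restrictPt_sectionPow_eq_prod (σ : Fin g ⊕ Fin g → A.Sections) (a : Fin g ⊕ Fin g → ZMod n) :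
    haveI := A.isCommMonObj_fibre s
    A.restrictPt s (A.sectionPow σ a) = ∏ k, A.restrictPt s (σ k) ^ (a k).val := by
  haveI := A.isCommMonObj_fibre s
  rw [A.restrictPt_sectionPow s σ a, List.prod_ofFn, List.prod_ofFn, Fintype.prod_sum_type]

/-- **Additivity in the exponent**: `(σ^{a+b})(s) = (σ^a)(s) · (σ^b)(s)` whenever every `σₖ(s)` is `n`-torsion
(e.g. `σₖ ^ n = 1`, via (O4) `restrictPt_pow_eq_one`) — Mumford's `Σ aᵢσᵢ(s)` is a HOMOMORPHISM
`(ℤ/n)^{2g} → X_s[n](Ω)`. [cite: MumfordFogartyKirwan1994, Ch. 7 §1 Definition 7.1 (p. 129)] -/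
theorem restrictPt_sectionPow_add [NeZero n] (σ : Fin g ⊕ Fin g → A.Sections)
    (hσ : ∀ k, A.restrictPt s (σ k) ^ n = 1) (a b : Fin g ⊕ Fin g → ZMod n) :
    A.restrictPt s (A.sectionPow σ (a + b)) = A.restrictPt s (A.sectionPow σ a) * A.restrictPt s (A.sectionPow σ b) := by
  haveI := A.isCommMonObj_fibre s
  rw [A.restrictPt_sectionPow_eq_prod s σ a, A.restrictPt_sectionPow_eq_prod s σ b,
    A.restrictPt_sectionPow_eq_prod s σ (a + b), ← Finset.prod_mul_distrib]
  exact Finset.prod_congr rfl fun k _ => by rw [Pi.add_apply, pow_val_add_of_pow_eq_one (hσ k)]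

/-- `(σ^0)(s) = 1`. [cite: MumfordFogartyKirwan1994, Ch. 7 §1 Definition 7.1 (p. 129)] -/
theorem restrictPt_sectionPow_zero (σ : Fin g ⊕ Fin g → A.Sections) :
    A.restrictPt s (A.sectionPow σ (0 : Fin g ⊕ Fin g → ZMod n)) = 1 := by
  rw [sectionPow_zero, restrictPt_one]

/-- `(σ^{m • a})(s) = ((σ^a)(s))^m` under the torsion hypothesis. [cite: MumfordFogartyKirwan1994, Ch. 7 §1 Definition 7.1 (p. 129)] -/
theorem restrictPt_sectionPow_nsmul [NeZero n] (σ : Fin g ⊕ Fin g → A.Sections)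
    (hσ : ∀ k, A.restrictPt s (σ k) ^ n = 1) (m : ℕ) (a : Fin g ⊕ Fin g → ZMod n) :
    A.restrictPt s (A.sectionPow σ (m • a)) = A.restrictPt s (A.sectionPow σ a) ^ m := by
  induction m with
  | zero => rw [zero_smul, pow_zero, restrictPt_sectionPow_zero]
  | succ m ih => rw [add_smul, one_smul, A.restrictPt_sectionPow_add s σ hσ, ih, pow_succ]

/-- The values `(σ^a)(s)` are `n`-torsion under the torsion hypothesis. [cite: MumfordFogartyKirwan1994, Ch. 7 §1 Definition 7.1 (p. 129)] -/
theorem restrictPt_sectionPow_pow_card [NeZero n] (σ : Fin g ⊕ Fin g → A.Sections)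
    (hσ : ∀ k, A.restrictPt s (σ k) ^ n = 1) (a : Fin g ⊕ Fin g → ZMod n) :
    A.restrictPt s (A.sectionPow σ a) ^ n = 1 := by
  rw [← A.restrictPt_sectionPow_nsmul s σ hσ n a]
  have : (n • a : Fin g ⊕ Fin g → ZMod n) = 0 := by
    ext k; simp
  rw [this, restrictPt_sectionPow_zero]

/-! ### §3 The matrix twist `σ ∘ γ̄` (COLUMNS; right action) and the cofactor power `σ^d`, read at `s` -/

/-- **`((σ∘γ̄)^a)(s) = (σ^{γ̄ a})(s)`** where `(σ∘γ̄)ᵢ := σ^{col_i γ̄} = ∏ⱼ σⱼ^{γ̄ⱼᵢ}` (the family twisted by the matrix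
`γ̄` through its COLUMNS — print's `η ↦ η ∘ γ̄`, the RIGHT action of [MumfordFogartyKirwan1994] App. 7A p. 236 /
[Deligne1971TravauxShimura] 4.12 (b)) and `γ̄ a = γ̄ *ᵥ a`; under the torsion hypothesis.  This is the identity W4's
`LevelStructure.twist` needs for its basis clauses (CENSUS-W4 §(i) (t2)); exponent arithmetic in the commutative
`A_s(Ω)` (`Finset.prod_comm`, `Finset.prod_pow`). [cite: MumfordFogartyKirwan1994, App. 7A (p. 236)] -/
theorem restrictPt_sectionPow_mulVec [NeZero n] (σ : Fin g ⊕ Fin g → A.Sections)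
    (hσ : ∀ k, A.restrictPt s (σ k) ^ n = 1)
    (γ : Matrix (Fin g ⊕ Fin g) (Fin g ⊕ Fin g) (ZMod n)) (a : Fin g ⊕ Fin g → ZMod n) :
    A.restrictPt s (A.sectionPow (fun i => A.sectionPow σ fun j => γ j i) a) =
      A.restrictPt s (A.sectionPow σ (γ *ᵥ a)) := by
  haveI := A.isCommMonObj_fibre s
  rw [A.restrictPt_sectionPow_eq_prod s _ a, A.restrictPt_sectionPow_eq_prod s σ (γ *ᵥ a)]
  simp_rw [A.restrictPt_sectionPow_eq_prod s σ]
  -- RHS exponent `(γ *ᵥ a) j = ∑ i, γ j i * a i`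
  have hR : ∀ j, A.restrictPt s (σ j) ^ ((γ *ᵥ a) j).val =
      ∏ i, (A.restrictPt s (σ j) ^ (γ j i).val) ^ (a i).val := by
    intro j
    rw [Matrix.mulVec, dotProduct, pow_val_sum_of_pow_eq_one (hσ j)]
    exact Finset.prod_congr rfl fun i _ => pow_val_mul_of_pow_eq_one (hσ j) _ _
  simp_rw [hR]
  rw [Finset.prod_comm]
  exact Finset.prod_congr rfl fun i _ => (Finset.prod_pow _ _ _).symm

/-- **`((σ^d)^a)(s) = (σ^{d·a})(s)`** for the family `σᵢ^d` — the cofactor form of the level-LOWERING map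
`A_{g,n} → A_{g,n′}`, `n = n′ d`: the level-`n′` structure `σ^d` of a level-`n` structure `σ`, exponents inflated by
`a ↦ (d · aᵢ) mod n` — under the torsion hypothesis at level `n`.  W2's `changeLevel` reads its basis clauses through
this identity (P30 (c1)/(c5)). [cite: MumfordFogartyKirwan1994, App. 7A (p. 235)] -/
theorem restrictPt_sectionPow_pow {n' : ℕ} (σ : Fin g ⊕ Fin g → A.Sections)
    (hσ : ∀ k, A.restrictPt s (σ k) ^ n = 1) (d : ℕ) (a : Fin g ⊕ Fin g → ZMod n') :
    A.restrictPt s (A.sectionPow (fun i => σ i ^ d) a) =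
      A.restrictPt s (A.sectionPow σ fun i => ((d * (a i).val : ℕ) : ZMod n)) := by
  haveI := A.isCommMonObj_fibre s
  rw [A.restrictPt_sectionPow_eq_prod s _ a, A.restrictPt_sectionPow_eq_prod s σ]
  exact Finset.prod_congr rfl fun k _ => by
    rw [restrictPt_pow, ← pow_mul, pow_val_natCast_of_pow_eq_one (hσ k)]

/-! ### §4 Transfer to the `LevelStructure` clause shapes (D1 v4 :430; `FibrePoints` currency) -/

/-- Restriction `σ ↦ σ|s` to the fibre in the `FibrePoints` currency is multiplicative (`MonObj.comp_mul`).
[cite: MumfordFogartyKirwan1994, Ch. 7 §1 Definition 7.1 (p. 129)] -/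
theorem restrict_mul (σ τ : A.Sections) : A.restrict s (σ * τ) = A.restrict s σ * A.restrict s τ :=
  MonObj.comp_mul _ _ _

/-- `1|s = 1` in the `FibrePoints` currency (`MonObj.comp_one`). [cite: MumfordFogartyKirwan1994, Ch. 7 §1 Definition 7.1 (p. 129)] -/
theorem restrict_one : A.restrict s (1 : A.Sections) = 1 :=
  MonObj.comp_one _

/-- `(σ^m)|s = (σ|s)^m` in the `FibrePoints` currency. [cite: MumfordFogartyKirwan1994, Ch. 7 §1 Definition 7.1 (p. 129)] -/
theorem restrict_pow (σ : A.Sections) (m : ℕ) : A.restrict s (σ ^ m) = A.restrict s σ ^ m := by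
  induction m with
  | zero => rw [pow_zero, pow_zero, restrict_one]
  | succ m ih => rw [pow_succ, pow_succ, restrict_mul, ih]

/-- The map `a ↦ (σ^a)|s` is injective iff `a ↦ (σ^a)(s)` is (the two currencies name the same point;
(O4) `restrictPt_eq_restrictPt_iff`). [cite: MumfordFogartyKirwan1994, Ch. 7 §1 Definition 7.1 (p. 129)] -/
theorem injective_restrict_sectionPow_iff (σ : Fin g ⊕ Fin g → A.Sections) :
    (Function.Injective fun a : Fin g ⊕ Fin g → ZMod n => A.restrict s (A.sectionPow σ a)) ↔
      Function.Injective fun a : Fin g ⊕ Fin g → ZMod n => A.restrictPt s (A.sectionPow σ a) := by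
  constructor
  · intro h a b hab
    exact h ((A.restrictPt_eq_restrictPt_iff s _ _).1 hab)
  · intro h a b hab
    exact h ((A.restrictPt_eq_restrictPt_iff s _ _).2 hab)

/-- **Basis injectivity transfers to the twisted family `σ∘γ̄` for invertible `γ̄`**: if `a ↦ (σ^a)|s` is injective
(D1 `basis_injective` at `s`) and the `σₖ` are `n`-torsion, then so is `a ↦ ((σ∘γ̄)^a)|s` — the `basis_injective` field of
W4's `LevelStructure.twist`. [cite: MumfordFogartyKirwan1994, App. 7A (p. 236)] -/
theorem basis_injective_mulVec [NeZero n] (σ : Fin g ⊕ Fin g → A.Sections) (hσn : ∀ k, σ k ^ n = 1)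
    (γ : Matrix (Fin g ⊕ Fin g) (Fin g ⊕ Fin g) (ZMod n)) (hγ : IsUnit γ)
    (hinj : Function.Injective fun a : Fin g ⊕ Fin g → ZMod n => A.restrict s (A.sectionPow σ a)) :
    Function.Injective fun a : Fin g ⊕ Fin g → ZMod n =>
      A.restrict s (A.sectionPow (fun i => A.sectionPow σ fun j => γ j i) a) := by
  have hσ : ∀ k, A.restrictPt s (σ k) ^ n = 1 := fun k => A.restrictPt_pow_eq_one s (hσn k)
  rw [injective_restrict_sectionPow_iff]
  rw [injective_restrict_sectionPow_iff] at hinj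
  intro a b hab
  have hab' : A.restrictPt s (A.sectionPow σ (γ *ᵥ a)) = A.restrictPt s (A.sectionPow σ (γ *ᵥ b)) := by
    rw [← A.restrictPt_sectionPow_mulVec s σ hσ, ← A.restrictPt_sectionPow_mulVec s σ hσ]
    exact hab
  exact mulVec_injective_of_isUnit hγ (hinj hab')

/-- **Basis surjectivity transfers to the twisted family `σ∘γ̄` for invertible `γ̄`** (onto the `n`-torsion of the
fibre, D1 `basis_surjective` shape) — the `basis_surjective` field of W4's `LevelStructure.twist`.
[cite: MumfordFogartyKirwan1994, App. 7A (p. 236)] -/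
theorem basis_surjective_mulVec [NeZero n] (σ : Fin g ⊕ Fin g → A.Sections) (hσn : ∀ k, σ k ^ n = 1)
    (γ : Matrix (Fin g ⊕ Fin g) (Fin g ⊕ Fin g) (ZMod n)) (hγ : IsUnit γ)
    (hsurj : ∀ x : A.FibrePoints s, x ^ n = 1 → ∃ a : Fin g ⊕ Fin g → ZMod n, A.restrict s (A.sectionPow σ a) = x)
    (x : A.FibrePoints s) (hx : x ^ n = 1) :
    ∃ a : Fin g ⊕ Fin g → ZMod n, A.restrict s (A.sectionPow (fun i => A.sectionPow σ fun j => γ j i) a) = x := by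
  have hσ : ∀ k, A.restrictPt s (σ k) ^ n = 1 := fun k => A.restrictPt_pow_eq_one s (hσn k)
  obtain ⟨a, ha⟩ := hsurj x hx
  obtain ⟨u, rfl⟩ := hγ
  refine ⟨(u⁻¹).val *ᵥ a, ?_⟩
  rw [← ha]
  refine (A.restrictPt_eq_restrictPt_iff s _ _).1 ?_
  have h := A.restrictPt_sectionPow_mulVec s σ hσ u.val ((u⁻¹).val *ᵥ a)
  rw [Matrix.mulVec_mulVec, Units.mul_inv, Matrix.one_mulVec] at h
  exact h

/-- **Basis injectivity transfers DOWN the level**: for `n = n′ d`, if `a ↦ (σ^a)|s` is injective on `(ℤ/n)^{2g}`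
then `a ↦ ((σ^d)^a)|s` is injective on `(ℤ/n′)^{2g}` — the `basis_injective` field of W2's
`LevelStructure.changeLevel` (P30 (c1)). [cite: MumfordFogartyKirwan1994, App. 7A (p. 235)] -/
theorem basis_injective_pow [NeZero n] {n' : ℕ} (σ : Fin g ⊕ Fin g → A.Sections) (hσn : ∀ k, σ k ^ n = 1)
    (d : ℕ) (hn : n = n' * d)
    (hinj : Function.Injective fun a : Fin g ⊕ Fin g → ZMod n => A.restrict s (A.sectionPow σ a)) :
    Function.Injective fun a : Fin g ⊕ Fin g → ZMod n' => A.restrict s (A.sectionPow (fun i => σ i ^ d) a) := by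
  have hσ : ∀ k, A.restrictPt s (σ k) ^ n = 1 := fun k => A.restrictPt_pow_eq_one s (hσn k)
  have hd : 0 < d := Nat.pos_of_ne_zero (by rintro rfl; exact (NeZero.ne n) (by rw [hn, mul_zero]))
  haveI : NeZero n' := ⟨by rintro rfl; exact (NeZero.ne n) (by rw [hn, zero_mul])⟩
  rw [injective_restrict_sectionPow_iff]
  rw [injective_restrict_sectionPow_iff] at hinj
  intro a b hab
  have hab' : A.restrictPt s (A.sectionPow σ fun i => ((d * (a i).val : ℕ) : ZMod n)) =
      A.restrictPt s (A.sectionPow σ fun i => ((d * (b i).val : ℕ) : ZMod n)) := by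
    rw [← A.restrictPt_sectionPow_pow s σ hσ, ← A.restrictPt_sectionPow_pow s σ hσ]
    exact hab
  have h := hinj hab'
  funext i
  have hi : ((d * (a i).val : ℕ) : ZMod n) = ((d * (b i).val : ℕ) : ZMod n) := congrFun h i
  -- `d * a.val, d * b.val < n`, so the casts are injective
  have hlt : ∀ c : ZMod n', d * c.val < n := fun c => by
    rw [hn, mul_comm n' d]
    exact (Nat.mul_lt_mul_left hd).2 (ZMod.val_lt c)
  have hval := congrArg ZMod.val hi
  rw [ZMod.val_natCast, ZMod.val_natCast, Nat.mod_eq_of_lt (hlt _), Nat.mod_eq_of_lt (hlt _)] at hval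
  exact ZMod.val_injective n' (Nat.eq_of_mul_eq_mul_left hd hval)

/-- **Basis surjectivity transfers DOWN the level**: for `n = n′ d`, if `a ↦ (σ^a)|s` is injective and maps onto the
`n`-torsion of the fibre, then `a ↦ ((σ^d)^a)|s` maps `(ℤ/n′)^{2g}` onto the `n′`-torsion — the `basis_surjective`
field of W2's `LevelStructure.changeLevel` (P30 (c1)): an `n′`-torsion point `x` is `n`-torsion, hence `x = (σ^c)|s`;
`x^{n′} = 1` and injectivity force `n′ c = 0`, i.e. `d ∣ cₖ`, so `c = d · a`.
[cite: MumfordFogartyKirwan1994, App. 7A (p. 235)] -/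
theorem basis_surjective_pow [NeZero n] {n' : ℕ} (σ : Fin g ⊕ Fin g → A.Sections) (hσn : ∀ k, σ k ^ n = 1)
    (d : ℕ) (hn : n = n' * d)
    (hinj : Function.Injective fun a : Fin g ⊕ Fin g → ZMod n => A.restrict s (A.sectionPow σ a))
    (hsurj : ∀ x : A.FibrePoints s, x ^ n = 1 → ∃ a : Fin g ⊕ Fin g → ZMod n, A.restrict s (A.sectionPow σ a) = x)
    (x : A.FibrePoints s) (hx : x ^ n' = 1) :
    ∃ a : Fin g ⊕ Fin g → ZMod n', A.restrict s (A.sectionPow (fun i => σ i ^ d) a) = x := by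
  have hσ : ∀ k, A.restrictPt s (σ k) ^ n = 1 := fun k => A.restrictPt_pow_eq_one s (hσn k)
  have hd : 0 < d := Nat.pos_of_ne_zero (by rintro rfl; exact (NeZero.ne n) (by rw [hn, mul_zero]))
  haveI : NeZero n' := ⟨by rintro rfl; exact (NeZero.ne n) (by rw [hn, zero_mul])⟩
  -- `x` is `n`-torsion, hence a value of the level-`n` basis
  have hxn : x ^ n = 1 := by rw [hn, pow_mul, hx, one_pow]
  obtain ⟨c, hc⟩ := hsurj x hxn
  -- `n′ • c = 0`: `(σ^{n′ • c})(s) = ((σ^c)(s))^{n′} = (x^{n′} read at s) = 1 = (σ^0)(s)`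
  have hinj' := (A.injective_restrict_sectionPow_iff s σ).1 hinj
  have hc0 : (n' • c : Fin g ⊕ Fin g → ZMod n) = 0 := by
    apply hinj'
    change A.restrictPt s (A.sectionPow σ (n' • c)) = A.restrictPt s (A.sectionPow σ 0)
    rw [A.restrictPt_sectionPow_nsmul s σ hσ, restrictPt_sectionPow_zero, ← restrictPt_pow, ← restrictPt_one]
    refine (A.restrictPt_eq_restrictPt_iff s _ _).2 ?_
    rw [restrict_pow, hc, hx, restrict_one]
  -- hence `d ∣ cₖ.val`; write `cₖ.val = d · qₖ`
  have hdiv : ∀ k, d ∣ (c k).val := by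
    intro k
    have hk : ((n' * (c k).val : ℕ) : ZMod n) = 0 := by
      have := congrFun hc0 k
      rw [Pi.smul_apply, Pi.zero_apply, nsmul_eq_mul] at this
      rw [Nat.cast_mul, ZMod.natCast_zmod_val]
      exact this
    have hk' : n' * d ∣ n' * (c k).val := by
      rw [← hn]
      exact (ZMod.natCast_eq_zero_iff _ _).1 hk
    exact Nat.dvd_of_mul_dvd_mul_left (Nat.pos_of_ne_zero (NeZero.ne n')) hk'
  choose q hq using hdiv
  refine ⟨fun k => (q k : ZMod n'), ?_⟩
  rw [← hc]
  refine (A.restrictPt_eq_restrictPt_iff s _ _).1 ?_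
  rw [A.restrictPt_sectionPow_pow s σ hσ]
  have hqlt : ∀ k, q k < n' := fun k => by
    have := ZMod.val_lt (c k)
    rw [hq k, hn, mul_comm n' d] at this
    exact Nat.lt_of_mul_lt_mul_left this
  have hfun : (fun i => ((d * ((q i : ZMod n')).val : ℕ) : ZMod n)) = c := by
    funext k
    rw [ZMod.val_natCast, Nat.mod_eq_of_lt (hqlt k), ← hq k, ZMod.natCast_zmod_val]
  rw [hfun]

end AbelianSchemeOver

end Literature.AlgebraicGeometry.AbelianSchemes

end
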